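import Summits.QuantumFields.BalabanUV.Beta.RemainderExplicitHistoryDiagonalComparison
import Summits.QuantumFields.BalabanUV.Beta.RemainderExplicitHistoryDiagonalRate

/-!
# RemainderExplicitHistoryDiagonalWindowEverywhere — ROAD P3, ORDER-0 PROFILE FAMILY: THE UPPER WINDOW LAW AT EVERY POSITION, NOT ONLY IN
# THE INFRARED HALF — along two infrared-pinned runs the window's own feedback term of generation 49's window identity is at most
# `(Wγ∕b)·max_{[j₀,K]} d ≤ (Wγ∕b)·d_{j₀}∕(1 − Wγ∕b)` (generation 50's comparison), so for EVERY `j₀ ≤ K`: `d_{j₀} ≤ C_w·((1∕√b)·𝒯 + Σ_{i<j₀}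
# ((g^A_i)³∕2)·d_i·(R(K−i) − R(j₀−i)))`, `C_w = (1 − Wγ∕b)∕(1 − 2Wγ∕b)` under `2Wγ < b`, or `C_w = 2` under `Wγ < b` once `2√2·Ts ≤ (1 − Wγ∕b)·
# b√b·K√K` (`Ts ≥ Σ_k τ(k+1)`) — first file of station S-d4p3-g51-1 «the tails alone buy the rate: (T1) and `m ≤ n+1` dropped, every `q ≥ 2`»

Cell `pub-balaban`, β-function sub-cell, BINDER row D4 «RemainderConst leaves for Bałaban's split» (`HOME/BINDER-OWNERS.md`; owner
lineage `b2b-balaban-beta-an4`; this file by co-owner #3 lineage `b2b-balaban-beta-d4-p3`, road P3 «the reduction road», generation 51,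
station S-d4p3-g51-1, first file; imports generation 50's `RemainderExplicitHistoryDiagonalComparison` and generation 49's
`RemainderExplicitHistoryDiagonalRate`), β-FLOW TEAM duty (1); FREEZE (0) honoured (def-free module in road P3's own `RemainderExplicit*`
series; no leaf, no interface, no Literature file).  SOURCE OF THE SHAPES ONLY: [Balaban1987RG1] (0.20) p. 256, (0.31) and Thm 2 p. 259,
§5 p. 298.  Pure real analysis about ONE explicit toy family (ours, not Bałaban's).

HONEST FRAMING (page 1 of everything the β sub-cell writes).  *"Discharging BetaPertH makes Bałaban's UV stability UNCONDITIONAL — a real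
constructive-QFT result; it is NOT the continuum limit and NOT the Clay problem."*  THIS FILE DISCHARGES NOTHING OF THE KIND.  Generation
49's rate theorem (`…Rate.disc_le_majorant`) runs a majorant induction over the INFRARED HALF of the short run only, because its upper window
law (`…WindowSource.window_law_upper`) drops the window's own feedback term `Σ_{i∈[j₀,K)} e_i·(R(K−i) − R(i+1))` by SIGN — non-positive only when
every window position is old (`2j₀ + 1 ≥ K`); the ultraviolet half was priced GLOBALLY (`uvHalf_le`, generation 48's sandwich) and converted
to the majorant shape `√(K−i)·τ(i+1)` through the hypothesis (T1) `Σρ(a)min(a,K)² ≤ A₁K²τ(K)` — true for power tails `q < 2`, FALSE for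
`q ≥ 2` (generation 50's census OPEN (ii′)).  THIS FILE removes the obstruction at its root: the window's own term is at most `W·Σ_{[j₀,K)} e`
(every weight is `≤ R(K−i) ≤ W`, every `e_i ≥ 0`), the window's coupling gaps are priced by the cubic conversion weight and the
asymptotic-freedom budget (`…Comparison.sum_gap_le`: `≤ (γ∕b)·max d`), and the maximum over `[j₀, K]` is within `1∕(1 − Wγ∕b)` of `d_{j₀}`
itself (`…Comparison.max_disc_le_disc_div`) — so the term is ABSORBED into the left side, at every position, for the constant
`C_w = (1 − Wγ∕b)∕(1 − 2Wγ∕b)` under the box-type smallness `2Wγ < b` (the one of generation 47's `runFamily_exists`), or — keeping generation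
49's `Wγ < b` — for `C_w = 2` above a cutoff threshold, since only the YOUNG window positions (`2i + 1 ≤ K`) have a positive weight,
`≤ τ(i+1)`, and their cubes are `≤ √2∕(b√b·K√K)` (§1).  The second file runs the majorant induction over the WHOLE run on this law: (T1)
disappears, and with it the restriction `m ≤ n + 1`.  Nothing of Bałaban's (1.22) is asserted or constructed; row D4 class UNCHANGED (critical-path width 0;
instance 0∕1; D4 DISCHARGE NO DATE); NOT B12 Thm 2, NOT BetaPertH, NOT continuum, NOT Clay.  HONEST DEPENDENCY: continuum YM on T⁴ ⇐
BetaPertH ∧ nine spine estimates (0/9 proved); BetaPertH ⇐ (D1) ∧ (D4) ∧ CAP+tail; G-an2-4 gates asym, D1 and NE2/3/4.  ABSOLUTE RULE: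
nothing is cited as a fact.

WHAT IS PROVED ([folklore]; 0 sorry; 0 `def`; the family as the hypothesis `hβ` on an abstract `β : FlowStep.HBeta`, `ρ ≥ 0`, `b > 0`; two
pinned runs A: `K` steps, B: `K + n` steps; `d_i = 1∕(g^B_{i+n})² − 1∕(g^A_i)²`, `e_i = g^A_i − g^B_{i+n}`, `R(k) = Σ_{a<k} ρ(a)`,
`𝒯 = Σ_{j∈[j₀,K)} (R(j+n+1) − R(j+1))∕√(K−j)`).
* §1 `inv_pow_three_halves_le`, **`inWindow_le_mul_sum_gap`** (`Σ_{i∈[j₀,K)} e_i(R(K−i) − R(i+1)) ≤ W·Σ_{[j₀,K)} e`,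
  no smallness), **`inWindow_le_max`** (`… ≤ (Wγ∕b)·P` for any bound `P ≥ 0` of `d` on `[j₀,K)`), **`inWindow_le_tailSum`** (with a tail majorant
  `τ ≥ 0`, `R(N) − R(k) ≤ τ(k)`, `Σ_{i<N} τ(i+1) ≤ Ts`, `K ≥ 1`: `… ≤ (√2·Ts∕(b√b·K√K))·P`).
* §2 `uvFeedback_le_cube`, **`window_law_upper_max`** (every `j₀ ≤ K`, any bound `P ≥ 0` of `d` on `[j₀,K)`:
  `d_{j₀} ≤ (1∕√b)𝒯 + Σ_{i<j₀}((g^A_i)³∕2)d_i(R(K−i) − R(j₀−i)) + (Wγ∕b)·P`), `window_law_upper_max_tail` (`… + (√2Ts∕(b√bK√K))·P`),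
  **`window_law_upper_everywhere`** (`2Wγ < b` ⇒ `d_{j₀} ≤ ((1−Wγ∕b)∕(1−2Wγ∕b))·((1∕√b)𝒯 + Σ_{i<j₀} …)` at EVERY `j₀ ≤ K`),
  **`window_law_upper_everywhere_tail`** (`Wγ < b`, `2√2Ts ≤ (1−Wγ∕b)b√b·K√K` ⇒ `d_{j₀} ≤ 2·((1∕√b)𝒯 + Σ_{i<j₀} …)` at EVERY `j₀ ≤ K`).
All letters NOT-IN-PRINT; `BetaFlowAsPrinted S` records a Markov β_n only ⇒ no junction of the as-printed interface changes.
-/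

noncomputable section

open Finset Filter Topology

namespace Summit.QuantumFields.BalabanUV.Beta.RemainderExplicitHistoryDiagonalWindowEverywhere

open Literature.MathematicalPhysics.QuantumFieldTheory.Balaban1983to89
open Literature.MathematicalPhysics.QuantumFieldTheory.Balaban1983to89.FlowStep
open Literature.MathematicalPhysics.QuantumFieldTheory.Balaban1983to89.T4CouplingMatching
open Summit.QuantumFields.BalabanUV.Beta.RemainderExplicitHistoryDiagonalMonotone
open Summit.QuantumFields.BalabanUV.Beta.RemainderExplicitHistoryDiagonalWeights
open Summit.QuantumFields.BalabanUV.Beta.RemainderExplicitHistoryDiagonalTwoRun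
open Summit.QuantumFields.BalabanUV.Beta.RemainderExplicitHistoryDiagonalWindow
open Summit.QuantumFields.BalabanUV.Beta.RemainderExplicitHistoryDiagonalWindowSource
open Summit.QuantumFields.BalabanUV.Beta.RemainderExplicitHistoryDiagonalComparison
open Summit.QuantumFields.BalabanUV.Beta.RemainderExplicitHistoryDiagonalRate

variable {β : HBeta} {b γ W : ℝ} {ρ τ : ℕ → ℝ}

/-! ## §1 The window's own feedback term, bounded instead of signed -/

/-- YOUNG WINDOW POSITIONS HAVE SMALL CUBES: for reals `0 < K ≤ 2s`, `1∕(s√s) ≤ 2√2∕(K√K)` (`K√K ≤ 2s·√2√s`). [folklore] -/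
theorem inv_pow_three_halves_le {K s : ℝ} (hK : 0 < K) (hKs : K ≤ 2 * s) :
    1 / (s * Real.sqrt s) ≤ 2 * Real.sqrt 2 / (K * Real.sqrt K) := by
  have hs : 0 < s := by linarith
  have hsK : 0 < Real.sqrt K := Real.sqrt_pos.2 hK
  have hss : 0 < Real.sqrt s := Real.sqrt_pos.2 hs
  have h1 : Real.sqrt K ≤ Real.sqrt 2 * Real.sqrt s := by
    rw [← Real.sqrt_mul (by norm_num : (0:ℝ) ≤ 2)]
    exact Real.sqrt_le_sqrt hKs
  rw [div_le_div_iff₀ (by positivity) (by positivity), one_mul]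
  calc K * Real.sqrt K ≤ (2 * s) * (Real.sqrt 2 * Real.sqrt s) := mul_le_mul hKs h1 hsK.le (by positivity)
    _ = 2 * Real.sqrt 2 * (s * Real.sqrt s) := by ring

/-- **THE WINDOW'S OWN TERM IS AT MOST `W` TIMES THE WINDOW'S COUPLING GAPS.**  Two runs of the order-0 profile family (`b > 0`, `ρ ≥ 0`,
`Σ_{a<N} ρ_a ≤ W`) — A: `K` steps, B: `K + n` steps, positive couplings — pinned `g^A_K = g^B_{K+n}`; for every `j₀ ≤ K`:
`Σ_{i∈[j₀,K)} e_i·(R(K−i) − R(i+1)) ≤ W·Σ_{i∈[j₀,K)} e_i` — each weight is `≤ R(K−i) ≤ W` (`R(i+1) ≥ 0`) and each `e_i ≥ 0` (maximum principle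
`…TwoRun.invSq_le_invSq_shift_run`).  No smallness, no sign condition on the position. [cite: Balaban1987RG1, (0.20) p.256 and Thm 2 p.259] -/
theorem inWindow_le_mul_sum_gap
    (hβ : ∀ (k : ℕ) (p : Fin (k + 1) → ℝ),
      β k p = b + ∑ i : Fin (k + 1), ρ (k - i) * min (p (Fin.last k)) (|p (Fin.last k) - p i|))
    (hb : 0 < b) (hρ0 : ∀ a, 0 ≤ ρ a) (hρW : ∀ n, ∑ a ∈ range n, ρ a ≤ W) {K n : ℕ} {gA gB : ℕ → ℝ}
    (hA : RGEqH K β gA) (hB : RGEqH (K + n) β gB) (hApos : ∀ k, k ≤ K → 0 < gA k)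
    (hBpos : ∀ k, k ≤ K + n → 0 < gB k) (hpin : gA K = gB (K + n)) (j₀ : ℕ) :
    ∑ i ∈ Ico j₀ K, (gA i - gB (i + n)) * (∑ a ∈ range (K - i), ρ a - ∑ a ∈ range (i + 1), ρ a)
      ≤ W * ∑ i ∈ Ico j₀ K, (gA i - gB (i + n)) := by
  have hdom := invSq_le_invSq_shift_run hβ hb hρ0 hA hB hApos hBpos hpin
  have he : ∀ i, i ≤ K → 0 ≤ gA i - gB (i + n) := fun i hi => by
    linarith [le_of_one_div_sq_le (hApos i hi) (hBpos (i + n) (by omega)) (hdom i hi)]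
  rw [Finset.mul_sum]
  refine Finset.sum_le_sum fun i hi => ?_
  have hi' := Finset.mem_Ico.mp hi
  have h1 := he i hi'.2.le
  have h2 : ∑ a ∈ range (K - i), ρ a - ∑ a ∈ range (i + 1), ρ a ≤ W := by
    have h3 := hρW (K - i)
    have h4 : 0 ≤ ∑ a ∈ range (i + 1), ρ a := Finset.sum_nonneg fun a _ => hρ0 a
    linarith
  calc (gA i - gB (i + n)) * (∑ a ∈ range (K - i), ρ a - ∑ a ∈ range (i + 1), ρ a)
      ≤ (gA i - gB (i + n)) * W := mul_le_mul_of_nonneg_left h2 h1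
    _ = W * (gA i - gB (i + n)) := by ring

/-- **THE WINDOW'S OWN TERM AGAINST A BOUND OF THE DISCREPANCY.**  Same two runs, couplings in ]0,γ] (`γ > 0`); if `d_i ≤ P` (`P ≥ 0`) for all
`i ∈ [j₀, K)`, then `Σ_{i∈[j₀,K)} e_i·(R(K−i) − R(i+1)) ≤ (Wγ∕b)·P` (`inWindow_le_mul_sum_gap` + `…Comparison.sum_gap_le`). [cite: Balaban1987RG1, (0.31) p.259] -/
theorem inWindow_le_max
    (hβ : ∀ (k : ℕ) (p : Fin (k + 1) → ℝ),
      β k p = b + ∑ i : Fin (k + 1), ρ (k - i) * min (p (Fin.last k)) (|p (Fin.last k) - p i|))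
    (hb : 0 < b) (hγ : 0 < γ) (hρ0 : ∀ a, 0 ≤ ρ a) (hρW : ∀ n, ∑ a ∈ range n, ρ a ≤ W) {K n : ℕ} {gA gB : ℕ → ℝ}
    (hA : RGEqH K β gA) (hB : RGEqH (K + n) β gB) (hAbox : ∀ k, k ≤ K → 0 < gA k ∧ gA k ≤ γ)
    (hBpos : ∀ k, k ≤ K + n → 0 < gB k) (hpin : gA K = gB (K + n)) {j₀ : ℕ} {P : ℝ}
    (hP : ∀ t, j₀ ≤ t → t < K → 1 / (gB (t + n)) ^ 2 - 1 / (gA t) ^ 2 ≤ P) (hP0 : 0 ≤ P) :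
    ∑ i ∈ Ico j₀ K, (gA i - gB (i + n)) * (∑ a ∈ range (K - i), ρ a - ∑ a ∈ range (i + 1), ρ a)
      ≤ W * γ / b * P := by
  have hApos : ∀ k, k ≤ K → 0 < gA k := fun k hk => (hAbox k hk).1
  have hW : 0 ≤ W := by simpa using hρW 0
  have h1 := inWindow_le_mul_sum_gap hβ hb hρ0 hρW hA hB hApos hBpos hpin j₀
  have h2 := sum_gap_le hβ hb hγ hρ0 hA hB hAbox hBpos hpin le_rfl hP hP0
  have h3 := mul_le_mul_of_nonneg_left h2 hW
  calc ∑ i ∈ Ico j₀ K, (gA i - gB (i + n)) * (∑ a ∈ range (K - i), ρ a - ∑ a ∈ range (i + 1), ρ a)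
      ≤ W * ∑ i ∈ Ico j₀ K, (gA i - gB (i + n)) := h1
    _ ≤ W * (γ / b * P) := h3
    _ = W * γ / b * P := by ring

/-- **THE WINDOW'S OWN TERM AGAINST A SUMMABLE TAIL MAJORANT.**  Same two runs in ]0,γ]; a tail majorant `τ ≥ 0` of the profile
(`R(N) − R(k) ≤ τ(k)` for `k ≤ N`) whose shifted partial sums are bounded, `Σ_{i<N} τ(i+1) ≤ Ts`; `K ≥ 1`; `d_i ≤ P` (`P ≥ 0`) on `[j₀, K)`.  THEN
`Σ_{i∈[j₀,K)} e_i·(R(K−i) − R(i+1)) ≤ (√2·Ts∕(b√b·K√K))·P` — only the YOUNG positions `2i + 1 ≤ K` have a positive weight, `≤ τ(i+1)`, and there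
`(g^A_i)³∕2 ≤ √2∕(b√b·K√K)` (`…Rate.cube_half_le`); old positions damp.  No smallness. [cite: Balaban1987RG1, (0.20) p.256, (0.31) and Thm 2 p.259] -/
theorem inWindow_le_tailSum
    (hβ : ∀ (k : ℕ) (p : Fin (k + 1) → ℝ),
      β k p = b + ∑ i : Fin (k + 1), ρ (k - i) * min (p (Fin.last k)) (|p (Fin.last k) - p i|))
    (hb : 0 < b) (hγ : 0 < γ) (hρ0 : ∀ a, 0 ≤ ρ a) {Ts : ℝ} (hτ0 : ∀ k, 0 ≤ τ k)
    (hτ : ∀ k N, k ≤ N → ∑ a ∈ range N, ρ a - ∑ a ∈ range k, ρ a ≤ τ k) (hTs : ∀ N, ∑ i ∈ range N, τ (i + 1) ≤ Ts)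
    {K n : ℕ} (hK : 1 ≤ K) {gA gB : ℕ → ℝ} (hA : RGEqH K β gA) (hB : RGEqH (K + n) β gB)
    (hAbox : ∀ k, k ≤ K → 0 < gA k ∧ gA k ≤ γ) (hBpos : ∀ k, k ≤ K + n → 0 < gB k) (hpin : gA K = gB (K + n)) {j₀ : ℕ} {P : ℝ}
    (hP : ∀ t, j₀ ≤ t → t < K → 1 / (gB (t + n)) ^ 2 - 1 / (gA t) ^ 2 ≤ P) (hP0 : 0 ≤ P) :
    ∑ i ∈ Ico j₀ K, (gA i - gB (i + n)) * (∑ a ∈ range (K - i), ρ a - ∑ a ∈ range (i + 1), ρ a)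
      ≤ Real.sqrt 2 * Ts / (b * Real.sqrt b * ((K : ℝ) * Real.sqrt (K : ℝ))) * P := by
  have hApos : ∀ k, k ≤ K → 0 < gA k := fun k hk => (hAbox k hk).1
  have hlo : BetaLowerH b γ β :=
    RemainderExplicitHistoryHalfMomentWitness.lower (γ := γ) (lam := fun k i => ρ (k - i)) hβ (fun k i => hρ0 _)
  have hdom := invSq_le_invSq_shift_run hβ hb hρ0 hA hB hApos hBpos hpin
  have hBA : ∀ i, i ≤ K → gB (i + n) ≤ gA i := fun i hi =>
    le_of_one_div_sq_le (hApos i hi) (hBpos (i + n) (by omega)) (hdom i hi)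
  have he : ∀ i, i ≤ K → 0 ≤ gA i - gB (i + n) := fun i hi => by linarith [hBA i hi]
  have hK0 : (0 : ℝ) < K := by exact_mod_cast hK
  have hTs0 : 0 ≤ Ts := le_trans (by simp) (hTs 0)
  set c : ℝ := Real.sqrt 2 / (b * Real.sqrt b * ((K : ℝ) * Real.sqrt (K : ℝ))) with hc
  have hc0 : 0 ≤ c := by positivity
  -- termwise: `e_i·w_i ≤ c·P·τ(i+1)`
  have hterm : ∀ i ∈ Ico j₀ K, (gA i - gB (i + n)) * (∑ a ∈ range (K - i), ρ a - ∑ a ∈ range (i + 1), ρ a)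
      ≤ c * P * τ (i + 1) := by
    intro i hi
    have hi' := Finset.mem_Ico.mp hi
    have hrhs : 0 ≤ c * P * τ (i + 1) := mul_nonneg (mul_nonneg hc0 hP0) (hτ0 _)
    by_cases hyoung : i + 1 ≤ K - i
    · -- young position: weight `≤ τ(i+1)`, cube `≤ c`
      have hw : ∑ a ∈ range (K - i), ρ a - ∑ a ∈ range (i + 1), ρ a ≤ τ (i + 1) := hτ (i + 1) (K - i) hyoung
      have hcube := cube_half_le hγ hb hA hAbox hlo hi'.2
      have hs : (0 : ℝ) < ((K - i : ℕ) : ℝ) := by exact_mod_cast (show 0 < K - i by omega)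
      have hKs : (K : ℝ) ≤ 2 * ((K - i : ℕ) : ℝ) := by exact_mod_cast (show K ≤ 2 * (K - i) by omega)
      have h32 := inv_pow_three_halves_le hK0 hKs
      have hcube' : (gA i) ^ 3 / 2 ≤ c := by
        refine hcube.trans ?_
        calc 1 / (2 * b * Real.sqrt b) * (1 / (((K - i : ℕ) : ℝ) * Real.sqrt ((K - i : ℕ) : ℝ)))
            ≤ 1 / (2 * b * Real.sqrt b) * (2 * Real.sqrt 2 / ((K : ℝ) * Real.sqrt (K : ℝ))) :=
              mul_le_mul_of_nonneg_left h32 (by positivity)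
          _ = c := by rw [hc]; field_simp
      have hgap : gA i - gB (i + n) ≤ (gA i) ^ 3 / 2 * P :=
        (gap_le_cube_mul (hBpos (i + n) (by omega)) (hBA i hi'.2.le)).trans
          (mul_le_mul_of_nonneg_left (hP i hi'.1 hi'.2) (by have := hApos i hi'.2.le; positivity))
      have hgap' : gA i - gB (i + n) ≤ c * P := hgap.trans (mul_le_mul_of_nonneg_right hcube' hP0)
      by_cases hw0 : 0 ≤ ∑ a ∈ range (K - i), ρ a - ∑ a ∈ range (i + 1), ρ a
      · exact mul_le_mul hgap' hw hw0 (mul_nonneg hc0 hP0)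
      · rw [not_le] at hw0
        exact le_trans (mul_nonpos_of_nonneg_of_nonpos (he i hi'.2.le) hw0.le) hrhs
    · -- old position: the weight is `≤ 0`
      have hw : ∑ a ∈ range (K - i), ρ a - ∑ a ∈ range (i + 1), ρ a ≤ 0 := by
        linarith [partialSum_mono hρ0 (show K - i ≤ i + 1 by omega)]
      exact le_trans (mul_nonpos_of_nonneg_of_nonpos (he i hi'.2.le) hw) hrhs
  calc ∑ i ∈ Ico j₀ K, (gA i - gB (i + n)) * (∑ a ∈ range (K - i), ρ a - ∑ a ∈ range (i + 1), ρ a)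
      ≤ ∑ i ∈ Ico j₀ K, c * P * τ (i + 1) := Finset.sum_le_sum hterm
    _ = c * P * ∑ i ∈ Ico j₀ K, τ (i + 1) := by rw [Finset.mul_sum]
    _ ≤ c * P * ∑ i ∈ range K, τ (i + 1) := by
        refine mul_le_mul_of_nonneg_left ?_ (mul_nonneg hc0 hP0)
        exact Finset.sum_le_sum_of_subset_of_nonneg (fun i hi => Finset.mem_range.mpr (Finset.mem_Ico.mp hi).2)
          fun i _ _ => hτ0 _
    _ ≤ c * P * Ts := mul_le_mul_of_nonneg_left (hTs K) (mul_nonneg hc0 hP0)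
    _ = Real.sqrt 2 * Ts / (b * Real.sqrt b * ((K : ℝ) * Real.sqrt (K : ℝ))) * P := by rw [hc]; ring

/-- THE ULTRAVIOLET FEEDBACK THROUGH THE CUBE: same two runs (positive couplings, pinned); for every `j₀ ≤ K`,
`Σ_{i<j₀} e_i·(R(K−i) − R(j₀−i)) ≤ Σ_{i<j₀} ((g^A_i)³∕2)·d_i·(R(K−i) − R(j₀−i))` (`…Weights.gap_le_cube_mul`, weights `≥ 0`). [cite: Balaban1987RG1, (0.31) p.259] -/
theorem uvFeedback_le_cube
    (hβ : ∀ (k : ℕ) (p : Fin (k + 1) → ℝ),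
      β k p = b + ∑ i : Fin (k + 1), ρ (k - i) * min (p (Fin.last k)) (|p (Fin.last k) - p i|))
    (hb : 0 < b) (hρ0 : ∀ a, 0 ≤ ρ a) {K n : ℕ} {gA gB : ℕ → ℝ} (hA : RGEqH K β gA) (hB : RGEqH (K + n) β gB)
    (hApos : ∀ k, k ≤ K → 0 < gA k) (hBpos : ∀ k, k ≤ K + n → 0 < gB k) (hpin : gA K = gB (K + n)) {j₀ : ℕ} (hj₀ : j₀ ≤ K) :
    ∑ i ∈ range j₀, (gA i - gB (i + n)) * (∑ a ∈ range (K - i), ρ a - ∑ a ∈ range (j₀ - i), ρ a)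
      ≤ ∑ i ∈ range j₀, (gA i) ^ 3 / 2 * (1 / (gB (i + n)) ^ 2 - 1 / (gA i) ^ 2)
          * (∑ a ∈ range (K - i), ρ a - ∑ a ∈ range (j₀ - i), ρ a) := by
  have hdom := invSq_le_invSq_shift_run hβ hb hρ0 hA hB hApos hBpos hpin
  refine Finset.sum_le_sum fun i hi => ?_
  have hi' : i ≤ K := by have := Finset.mem_range.mp hi; omega
  have hR : 0 ≤ ∑ a ∈ range (K - i), ρ a - ∑ a ∈ range (j₀ - i), ρ a := by
    linarith [partialSum_mono hρ0 (show j₀ - i ≤ K - i by omega)]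
  exact mul_le_mul_of_nonneg_right (gap_le_cube_mul (hBpos (i + n) (by omega))
    (le_of_one_div_sq_le (hApos i hi') (hBpos (i + n) (by omega)) (hdom i hi'))) hR

/-! ## §2 The upper window law at every position -/

/-- **UPPER WINDOW LAW AT EVERY POSITION, AGAINST A BOUND OF THE WINDOW.**  Two runs of the order-0 profile family in ]0,γ] (`b > 0`, `γ > 0`,
`ρ ≥ 0`, `Σ_{a<N} ρ_a ≤ W`) — A: `K` steps, B: `K + n` steps — pinned `g^A_K = g^B_{K+n}`; ANY position `j₀ ≤ K` and any bound `P ≥ 0` of the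
discrepancies on `[j₀, K)`.  THEN `d_{j₀} ≤ (1∕√b)·𝒯 + Σ_{i<j₀} ((g^A_i)³∕2)·d_i·(R(K−i) − R(j₀−i)) + (Wγ∕b)·P` — the window identity's three terms by
`…WindowSource.sum_extra_le_tailWindow`, `uvFeedback_le_cube`, `inWindow_le_max`; NO infrared-half condition. [cite: Balaban1987RG1, (0.20) p.256, Thm 2 p.259] -/
theorem window_law_upper_max
    (hβ : ∀ (k : ℕ) (p : Fin (k + 1) → ℝ),
      β k p = b + ∑ i : Fin (k + 1), ρ (k - i) * min (p (Fin.last k)) (|p (Fin.last k) - p i|))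
    (hb : 0 < b) (hγ : 0 < γ) (hρ0 : ∀ a, 0 ≤ ρ a) (hρW : ∀ n, ∑ a ∈ range n, ρ a ≤ W) {K n : ℕ} {gA gB : ℕ → ℝ}
    (hA : RGEqH K β gA) (hB : RGEqH (K + n) β gB) (hAbox : ∀ k, k ≤ K → 0 < gA k ∧ gA k ≤ γ)
    (hBbox : ∀ k, k ≤ K + n → 0 < gB k ∧ gB k ≤ γ) (hpin : gA K = gB (K + n)) {j₀ : ℕ} (hj₀ : j₀ ≤ K) {P : ℝ}
    (hP : ∀ t, j₀ ≤ t → t < K → 1 / (gB (t + n)) ^ 2 - 1 / (gA t) ^ 2 ≤ P) (hP0 : 0 ≤ P) :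
    1 / (gB (j₀ + n)) ^ 2 - 1 / (gA j₀) ^ 2
      ≤ 1 / Real.sqrt b * (∑ j ∈ Ico j₀ K, (∑ a ∈ range (j + n + 1), ρ a - ∑ a ∈ range (j + 1), ρ a) / Real.sqrt ((K - j : ℕ) : ℝ))
        + (∑ i ∈ range j₀, (gA i) ^ 3 / 2 * (1 / (gB (i + n)) ^ 2 - 1 / (gA i) ^ 2)
            * (∑ a ∈ range (K - i), ρ a - ∑ a ∈ range (j₀ - i), ρ a))
        + W * γ / b * P := by
  have hApos : ∀ k, k ≤ K → 0 < gA k := fun k hk => (hAbox k hk).1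
  have hBpos : ∀ k, k ≤ K + n → 0 < gB k := fun k hk => (hBbox k hk).1
  have hid := window_identity hβ hb hρ0 hA hB hApos hBpos hpin hj₀
  have hS := sum_extra_le_tailWindow hβ hb hρ0 hB hBbox (j₀ := j₀) (K := K)
  have hF := uvFeedback_le_cube hβ hb hρ0 hA hB hApos hBpos hpin hj₀
  have hD := inWindow_le_max hβ hb hγ hρ0 hρW hA hB hAbox hBpos hpin hP hP0
  linarith [hid, hS, hF, hD]

/-- THE SAME AGAINST A SUMMABLE TAIL MAJORANT: with `τ ≥ 0`, `R(N) − R(k) ≤ τ(k)`, `Σ_{i<N} τ(i+1) ≤ Ts`, `K ≥ 1`: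
`d_{j₀} ≤ (1∕√b)·𝒯 + Σ_{i<j₀} ((g^A_i)³∕2)·d_i·(R(K−i) − R(j₀−i)) + (√2Ts∕(b√b·K√K))·P` (`inWindow_le_tailSum`; no smallness).
[cite: Balaban1987RG1, (0.20) p.256, (0.31) and Thm 2 p.259] -/
theorem window_law_upper_max_tail
    (hβ : ∀ (k : ℕ) (p : Fin (k + 1) → ℝ),
      β k p = b + ∑ i : Fin (k + 1), ρ (k - i) * min (p (Fin.last k)) (|p (Fin.last k) - p i|))
    (hb : 0 < b) (hγ : 0 < γ) (hρ0 : ∀ a, 0 ≤ ρ a) {Ts : ℝ} (hτ0 : ∀ k, 0 ≤ τ k)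
    (hτ : ∀ k N, k ≤ N → ∑ a ∈ range N, ρ a - ∑ a ∈ range k, ρ a ≤ τ k) (hTs : ∀ N, ∑ i ∈ range N, τ (i + 1) ≤ Ts)
    {K n : ℕ} (hK : 1 ≤ K) {gA gB : ℕ → ℝ} (hA : RGEqH K β gA) (hB : RGEqH (K + n) β gB)
    (hAbox : ∀ k, k ≤ K → 0 < gA k ∧ gA k ≤ γ) (hBbox : ∀ k, k ≤ K + n → 0 < gB k ∧ gB k ≤ γ) (hpin : gA K = gB (K + n))
    {j₀ : ℕ} (hj₀ : j₀ ≤ K) {P : ℝ} (hP : ∀ t, j₀ ≤ t → t < K → 1 / (gB (t + n)) ^ 2 - 1 / (gA t) ^ 2 ≤ P) (hP0 : 0 ≤ P) :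
    1 / (gB (j₀ + n)) ^ 2 - 1 / (gA j₀) ^ 2
      ≤ 1 / Real.sqrt b * (∑ j ∈ Ico j₀ K, (∑ a ∈ range (j + n + 1), ρ a - ∑ a ∈ range (j + 1), ρ a) / Real.sqrt ((K - j : ℕ) : ℝ))
        + (∑ i ∈ range j₀, (gA i) ^ 3 / 2 * (1 / (gB (i + n)) ^ 2 - 1 / (gA i) ^ 2)
            * (∑ a ∈ range (K - i), ρ a - ∑ a ∈ range (j₀ - i), ρ a))
        + Real.sqrt 2 * Ts / (b * Real.sqrt b * ((K : ℝ) * Real.sqrt (K : ℝ))) * P := by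
  have hApos : ∀ k, k ≤ K → 0 < gA k := fun k hk => (hAbox k hk).1
  have hBpos : ∀ k, k ≤ K + n → 0 < gB k := fun k hk => (hBbox k hk).1
  have hid := window_identity hβ hb hρ0 hA hB hApos hBpos hpin hj₀
  have hS := sum_extra_le_tailWindow hβ hb hρ0 hB hBbox (j₀ := j₀) (K := K)
  have hF := uvFeedback_le_cube hβ hb hρ0 hA hB hApos hBpos hpin hj₀
  have hD := inWindow_le_tailSum hβ hb hγ hρ0 hτ0 hτ hTs hK hA hB hAbox hBpos hpin hP hP0
  linarith [hid, hS, hF, hD]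

/-- **ROAD P3 — THE UPPER WINDOW LAW AT EVERY POSITION** (box-type smallness).  Two runs of the order-0 profile family in ]0,γ] (`b > 0`,
`γ > 0`, `ρ ≥ 0`, `Σ_{a<N} ρ_a ≤ W`, **`2Wγ < b`**) — A: `K` steps, B: `K + n` steps — pinned `g^A_K = g^B_{K+n}`.  THEN at EVERY position `j₀ ≤ K`:
`d_{j₀} ≤ ((1 − Wγ∕b)∕(1 − 2Wγ∕b))·((1∕√b)·𝒯 + Σ_{i<j₀} ((g^A_i)³∕2)·d_i·(R(K−i) − R(j₀−i)))` — `window_law_upper_max` with `P = d_{j₀}∕(1 − Wγ∕b)`, the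
window maximum by `…Comparison.max_disc_le_disc_div`, absorbed: `1 − (Wγ∕b)∕(1 − Wγ∕b) = (1 − 2Wγ∕b)∕(1 − Wγ∕b) > 0`.  Generation 49's
`window_law_upper` is the infrared-half case with constant `1`. [cite: Balaban1987RG1, (0.20) p.256, (0.31) and Thm 2 p.259] -/
theorem window_law_upper_everywhere
    (hβ : ∀ (k : ℕ) (p : Fin (k + 1) → ℝ),
      β k p = b + ∑ i : Fin (k + 1), ρ (k - i) * min (p (Fin.last k)) (|p (Fin.last k) - p i|))
    (hb : 0 < b) (hγ : 0 < γ) (hρ0 : ∀ a, 0 ≤ ρ a) (hρW : ∀ n, ∑ a ∈ range n, ρ a ≤ W) (hsmall2 : 2 * W * γ < b) {K n : ℕ}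
    {gA gB : ℕ → ℝ} (hA : RGEqH K β gA) (hB : RGEqH (K + n) β gB) (hAbox : ∀ k, k ≤ K → 0 < gA k ∧ gA k ≤ γ)
    (hBbox : ∀ k, k ≤ K + n → 0 < gB k ∧ gB k ≤ γ) (hpin : gA K = gB (K + n)) {j₀ : ℕ} (hj₀ : j₀ ≤ K) :
    1 / (gB (j₀ + n)) ^ 2 - 1 / (gA j₀) ^ 2
      ≤ (1 - W * γ / b) / (1 - 2 * W * γ / b)
        * (1 / Real.sqrt b * (∑ j ∈ Ico j₀ K, (∑ a ∈ range (j + n + 1), ρ a - ∑ a ∈ range (j + 1), ρ a) / Real.sqrt ((K - j : ℕ) : ℝ))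
          + ∑ i ∈ range j₀, (gA i) ^ 3 / 2 * (1 / (gB (i + n)) ^ 2 - 1 / (gA i) ^ 2)
              * (∑ a ∈ range (K - i), ρ a - ∑ a ∈ range (j₀ - i), ρ a)) := by
  have hApos : ∀ k, k ≤ K → 0 < gA k := fun k hk => (hAbox k hk).1
  have hBpos : ∀ k, k ≤ K + n → 0 < gB k := fun k hk => (hBbox k hk).1
  have hW : 0 ≤ W := by simpa using hρW 0
  have hsmall : W * γ < b := by nlinarith
  have hx : W * γ / b < 1 / 2 := by rw [div_lt_iff₀ hb]; linarith
  have hx0 : 0 ≤ W * γ / b := by positivity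
  have hc1 : 0 < 1 - W * γ / b := by linarith
  have hc2 : 0 < 1 - 2 * W * γ / b := by
    have : 2 * W * γ / b = 2 * (W * γ / b) := by ring
    rw [this]; linarith
  have hdom := invSq_le_invSq_shift_run hβ hb hρ0 hA hB hApos hBpos hpin
  set d₀ : ℝ := 1 / (gB (j₀ + n)) ^ 2 - 1 / (gA j₀) ^ 2 with hd₀
  have hd₀0 : 0 ≤ d₀ := by have := hdom j₀ hj₀; rw [hd₀]; linarith
  -- the window's discrepancies are `≤ d₀∕(1 − Wγ∕b)`
  have hmax := max_disc_le_disc_div hβ hb hγ hρ0 hρW hsmall hA hB hAbox hBpos hpin j₀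
  have hP : ∀ t, j₀ ≤ t → t < K → 1 / (gB (t + n)) ^ 2 - 1 / (gA t) ^ 2 ≤ d₀ / (1 - W * γ / b) :=
    fun t h1 h2 => hmax t (Finset.mem_Icc.mpr ⟨h1, h2.le⟩)
  have hP0 : 0 ≤ d₀ / (1 - W * γ / b) := div_nonneg hd₀0 hc1.le
  have hlaw := window_law_upper_max hβ hb hγ hρ0 hρW hA hB hAbox hBbox hpin hj₀ hP hP0
  set SF : ℝ := 1 / Real.sqrt b * (∑ j ∈ Ico j₀ K, (∑ a ∈ range (j + n + 1), ρ a - ∑ a ∈ range (j + 1), ρ a)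
      / Real.sqrt ((K - j : ℕ) : ℝ))
    + ∑ i ∈ range j₀, (gA i) ^ 3 / 2 * (1 / (gB (i + n)) ^ 2 - 1 / (gA i) ^ 2)
        * (∑ a ∈ range (K - i), ρ a - ∑ a ∈ range (j₀ - i), ρ a) with hSF
  have h1 : d₀ ≤ SF + W * γ / b * (d₀ / (1 - W * γ / b)) := by rw [hSF]; linarith [hlaw]
  -- absorption: multiply by `1 − Wγ∕b`
  have h2 : d₀ * (1 - W * γ / b) ≤ SF * (1 - W * γ / b) + W * γ / b * d₀ := by
    have h := mul_le_mul_of_nonneg_right h1 hc1.le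
    have e : W * γ / b * (d₀ / (1 - W * γ / b)) * (1 - W * γ / b) = W * γ / b * d₀ := by
      rw [mul_assoc, div_mul_cancel₀ _ hc1.ne']
    calc d₀ * (1 - W * γ / b) ≤ (SF + W * γ / b * (d₀ / (1 - W * γ / b))) * (1 - W * γ / b) := h
      _ = SF * (1 - W * γ / b) + W * γ / b * (d₀ / (1 - W * γ / b)) * (1 - W * γ / b) := by ring
      _ = SF * (1 - W * γ / b) + W * γ / b * d₀ := by rw [e]
  have h3 : d₀ * (1 - 2 * W * γ / b) ≤ SF * (1 - W * γ / b) := by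
    have e : d₀ * (1 - 2 * W * γ / b) = d₀ * (1 - W * γ / b) - W * γ / b * d₀ := by ring
    rw [e]; linarith
  calc d₀ = d₀ * (1 - 2 * W * γ / b) / (1 - 2 * W * γ / b) := by rw [mul_div_assoc, div_self hc2.ne', mul_one]
    _ ≤ SF * (1 - W * γ / b) / (1 - 2 * W * γ / b) := div_le_div_of_nonneg_right h3 hc2.le
    _ = (1 - W * γ / b) / (1 - 2 * W * γ / b) * SF := by ring

/-- **ROAD P3 — THE UPPER WINDOW LAW AT EVERY POSITION ABOVE A CUTOFF THRESHOLD** (generation 49's smallness).  Two runs of the order-0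
profile family in ]0,γ] (`b > 0`, `γ > 0`, `ρ ≥ 0`, `Σ_{a<N} ρ_a ≤ W`, **`Wγ < b`**) — A: `K` steps, B: `K + n` steps — pinned `g^A_K = g^B_{K+n}`;
a tail majorant `τ ≥ 0` (`R(N) − R(k) ≤ τ(k)`) with `Σ_{i<N} τ(i+1) ≤ Ts`; the cutoff threshold `2√2·Ts ≤ (1 − Wγ∕b)·b√b·K√K`.  THEN at EVERY
position `j₀ ≤ K`: `d_{j₀} ≤ 2·((1∕√b)·𝒯 + Σ_{i<j₀} ((g^A_i)³∕2)·d_i·(R(K−i) − R(j₀−i)))` (`window_law_upper_max_tail` with `P = d_{j₀}∕(1 − Wγ∕b)`;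
the window's own term is then `≤ d_{j₀}∕2`). [cite: Balaban1987RG1, (0.20) p.256, (0.31) and Thm 2 p.259] -/
theorem window_law_upper_everywhere_tail
    (hβ : ∀ (k : ℕ) (p : Fin (k + 1) → ℝ),
      β k p = b + ∑ i : Fin (k + 1), ρ (k - i) * min (p (Fin.last k)) (|p (Fin.last k) - p i|))
    (hb : 0 < b) (hγ : 0 < γ) (hρ0 : ∀ a, 0 ≤ ρ a) (hρW : ∀ n, ∑ a ∈ range n, ρ a ≤ W) (hsmall : W * γ < b) {Ts : ℝ}
    (hτ0 : ∀ k, 0 ≤ τ k) (hτ : ∀ k N, k ≤ N → ∑ a ∈ range N, ρ a - ∑ a ∈ range k, ρ a ≤ τ k)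
    (hTs : ∀ N, ∑ i ∈ range N, τ (i + 1) ≤ Ts) {K n : ℕ}
    (hKthr : 2 * Real.sqrt 2 * Ts ≤ (1 - W * γ / b) * (b * Real.sqrt b) * ((K : ℝ) * Real.sqrt (K : ℝ)))
    {gA gB : ℕ → ℝ} (hA : RGEqH K β gA) (hB : RGEqH (K + n) β gB) (hAbox : ∀ k, k ≤ K → 0 < gA k ∧ gA k ≤ γ)
    (hBbox : ∀ k, k ≤ K + n → 0 < gB k ∧ gB k ≤ γ) (hpin : gA K = gB (K + n)) {j₀ : ℕ} (hj₀ : j₀ ≤ K) :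
    1 / (gB (j₀ + n)) ^ 2 - 1 / (gA j₀) ^ 2
      ≤ 2 * (1 / Real.sqrt b * (∑ j ∈ Ico j₀ K, (∑ a ∈ range (j + n + 1), ρ a - ∑ a ∈ range (j + 1), ρ a) / Real.sqrt ((K - j : ℕ) : ℝ))
          + ∑ i ∈ range j₀, (gA i) ^ 3 / 2 * (1 / (gB (i + n)) ^ 2 - 1 / (gA i) ^ 2)
              * (∑ a ∈ range (K - i), ρ a - ∑ a ∈ range (j₀ - i), ρ a)) := by
  have hApos : ∀ k, k ≤ K → 0 < gA k := fun k hk => (hAbox k hk).1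
  have hBpos : ∀ k, k ≤ K + n → 0 < gB k := fun k hk => (hBbox k hk).1
  have hW : 0 ≤ W := by simpa using hρW 0
  have hc1 : 0 < 1 - W * γ / b := by
    have : W * γ / b < 1 := (div_lt_one hb).mpr hsmall
    linarith
  have hsb : 0 < Real.sqrt b := Real.sqrt_pos.2 hb
  have hTs0 : 0 ≤ Ts := le_trans (by simp) (hTs 0)
  have hdom := invSq_le_invSq_shift_run hβ hb hρ0 hA hB hApos hBpos hpin
  set d₀ : ℝ := 1 / (gB (j₀ + n)) ^ 2 - 1 / (gA j₀) ^ 2 with hd₀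
  have hd₀0 : 0 ≤ d₀ := by have := hdom j₀ hj₀; rw [hd₀]; linarith
  set SF : ℝ := 1 / Real.sqrt b * (∑ j ∈ Ico j₀ K, (∑ a ∈ range (j + n + 1), ρ a - ∑ a ∈ range (j + 1), ρ a)
      / Real.sqrt ((K - j : ℕ) : ℝ))
    + ∑ i ∈ range j₀, (gA i) ^ 3 / 2 * (1 / (gB (i + n)) ^ 2 - 1 / (gA i) ^ 2)
        * (∑ a ∈ range (K - i), ρ a - ∑ a ∈ range (j₀ - i), ρ a) with hSF
  rcases Nat.eq_or_lt_of_le hj₀ with hjK | hjK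
  · -- at the pin `d₀ = 0`, and the right side is `≥ 0`
    have h0 : d₀ = 0 := by simp [hd₀, hjK, hpin]
    have hSF0 : 0 ≤ SF := by
      rw [hSF]
      refine add_nonneg (mul_nonneg (by positivity) (Finset.sum_nonneg fun j hj => ?_)) (Finset.sum_nonneg fun i hi => ?_)
      · have hj' := Finset.mem_Ico.mp hj
        exact div_nonneg (by linarith [partialSum_mono hρ0 (show j + 1 ≤ j + n + 1 by omega)]) (Real.sqrt_nonneg _)
      · have hi' : i ≤ K := by have := Finset.mem_range.mp hi; omega
        have hdi : 0 ≤ 1 / (gB (i + n)) ^ 2 - 1 / (gA i) ^ 2 := by linarith [hdom i hi']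
        have hR : 0 ≤ ∑ a ∈ range (K - i), ρ a - ∑ a ∈ range (j₀ - i), ρ a := by
          linarith [partialSum_mono hρ0 (show j₀ - i ≤ K - i by omega)]
        have hg : 0 ≤ (gA i) ^ 3 / 2 := by have := hApos i hi'; positivity
        exact mul_nonneg (mul_nonneg hg hdi) hR
    show d₀ ≤ 2 * SF
    rw [h0]; positivity
  have hK : 1 ≤ K := by omega
  have hK0 : (0 : ℝ) < K := by exact_mod_cast hK
  -- the window's discrepancies are `≤ d₀∕(1 − Wγ∕b)`
  have hmax := max_disc_le_disc_div hβ hb hγ hρ0 hρW hsmall hA hB hAbox hBpos hpin j₀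
  have hP : ∀ t, j₀ ≤ t → t < K → 1 / (gB (t + n)) ^ 2 - 1 / (gA t) ^ 2 ≤ d₀ / (1 - W * γ / b) :=
    fun t h1 h2 => hmax t (Finset.mem_Icc.mpr ⟨h1, h2.le⟩)
  have hP0 : 0 ≤ d₀ / (1 - W * γ / b) := div_nonneg hd₀0 hc1.le
  have hlaw := window_law_upper_max_tail hβ hb hγ hρ0 hτ0 hτ hTs hK hA hB hAbox hBbox hpin hj₀ hP hP0
  have h1 : d₀ ≤ SF + Real.sqrt 2 * Ts / (b * Real.sqrt b * ((K : ℝ) * Real.sqrt (K : ℝ))) * (d₀ / (1 - W * γ / b)) := by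
    rw [hSF]; linarith [hlaw]
  -- the threshold makes the coefficient `≤ (1 − Wγ∕b)∕2`
  have hA : Real.sqrt 2 * Ts / (b * Real.sqrt b * ((K : ℝ) * Real.sqrt (K : ℝ))) ≤ (1 - W * γ / b) / 2 := by
    rw [div_le_iff₀ (by positivity)]
    have e : (1 - W * γ / b) / 2 * (b * Real.sqrt b * ((K : ℝ) * Real.sqrt (K : ℝ)))
        = ((1 - W * γ / b) * (b * Real.sqrt b) * ((K : ℝ) * Real.sqrt (K : ℝ))) / 2 := by ring
    rw [e]; linarith
  have hcoef : Real.sqrt 2 * Ts / (b * Real.sqrt b * ((K : ℝ) * Real.sqrt (K : ℝ))) * (d₀ / (1 - W * γ / b)) ≤ d₀ / 2 := by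
    calc Real.sqrt 2 * Ts / (b * Real.sqrt b * ((K : ℝ) * Real.sqrt (K : ℝ))) * (d₀ / (1 - W * γ / b))
        ≤ (1 - W * γ / b) / 2 * (d₀ / (1 - W * γ / b)) := mul_le_mul_of_nonneg_right hA hP0
      _ = d₀ / 2 := by
          rw [div_mul_div_comm, mul_comm (1 - W * γ / b) d₀, mul_div_mul_right _ _ hc1.ne']
  show d₀ ≤ 2 * SF
  linarith

end Summit.QuantumFields.BalabanUV.Beta.RemainderExplicitHistoryDiagonalWindowEverywhere

end
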